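import Mathlib
import Summits.NavierStokesRegularity.NavierStokesRegularity.Theses.PerpetualPump

/-!
# Sketch — crux-ideate stmt-NavierStokesRegularity-1836 (CircuitTrace), ideator 2, round 1

First lemmas of the three idea cards, typed over Mathlib + the route file only.
Nothing here is proved except the encoding check `circuitTrace_iff`.
-/

namespace Summit.NavierStokesRegularity.NavierStokesRegularity.Cruxes.CircuitTrace.Ideator2

open scoped BigOperators
open Set

noncomputable section

/-- Tao's circuit right-hand side, *verbatim* the `let F` of `PerpetualPump.CircuitTrace`
(offset set S = {(0,0,0),(1,0,0),(0,1,0),(0,0,1)} labelled `Option (Fin 3)`, α = 2/5: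
dissipation `lam^{4n/5}`, interaction strength `lam^{n}`). -/
def circuitRHS (lam : ℝ) {m : ℕ} (coeff : Fin m → Fin m → Fin m → Option (Fin 3) → ℝ)
    (X : Fin m → ℤ → ℝ → ℝ) (i : Fin m) (n : ℤ) (t : ℝ) : ℝ :=
  -(lam ^ ((4 / 5 : ℝ) * n)) * X i n t +
    ∑ i₁ : Fin m, ∑ i₂ : Fin m, ∑ μ : Option (Fin 3),
      coeff i₁ i₂ i μ * lam ^ ((n : ℝ) - (if μ = some 2 then 1 else 0)) *
        X i₁ (n + ((if μ = some 0 then 1 else 0) - (if μ = some 2 then 1 else 0))) t *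
        X i₂ (n + ((if μ = some 1 then 1 else 0) - (if μ = some 2 then 1 else 0))) t

/-- Tao's symmetry (4.2) of the structure constants. -/
def IsSym {m : ℕ} (coeff : Fin m → Fin m → Fin m → Option (Fin 3) → ℝ) : Prop :=
  ∀ (i₁ i₂ i₃ : Fin m) (μ : Option (Fin 3)),
    coeff i₁ i₂ i₃ μ = coeff i₂ i₁ i₃ (Option.map (Equiv.swap (0 : Fin 3) 1) μ)

/-- Cyclic cancellation (energy conservation of the trilinear form). -/
def IsCyc {m : ℕ} (coeff : Fin m → Fin m → Fin m → Option (Fin 3) → ℝ) : Prop :=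
  ∀ (v : Fin 3 → Fin m) (μ : Option (Fin 3)),
    ∑ σ : Equiv.Perm (Fin 3), coeff (v (σ 0)) (v (σ 1)) (v (σ 2)) (Option.map σ.symm μ) = 0

/-- Euclidean norm of the vector of modes at scale `n` (rotor-invariant). -/
def modeNorm {m : ℕ} (X : Fin m → ℤ → ℝ → ℝ) (n : ℤ) (t : ℝ) : ℝ :=
  Real.sqrt (∑ i : Fin m, X i n t ^ 2)

/-- Critical amplitude `a_n(t) = lam^{n/5} |X_{·,n}(t)|` (the ℓ^∞-in-scale critical weight;
`Σ_n a_n³` is the crux's ℓ³ norm). -/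
def critAmp (lam : ℝ) {m : ℕ} (X : Fin m → ℤ → ℝ → ℝ) (n : ℤ) (t : ℝ) : ℝ :=
  lam ^ ((1 / 5 : ℝ) * n) * modeNorm X n t

/-- Encoding check: the crux, restated through `circuitRHS`, is *definitionally* the route decl. -/
theorem circuitTrace_iff :
    Summit.NavierStokesRegularity.NavierStokesRegularity.Theses.PerpetualPump.CircuitTrace ↔
    ∀ lam : ℝ, 1 < lam → ∀ (m : ℕ) (coeff : Fin m → Fin m → Fin m → Option (Fin 3) → ℝ),
      IsSym coeff → IsCyc coeff → ∀ T : ℝ, 0 < T → ∀ X : Fin m → ℤ → ℝ → ℝ,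
      (∀ (i : Fin m) (n : ℤ), ContinuousOn (X i n) (Set.Ico 0 T)) →
      (∀ (i : Fin m) (n : ℤ), ∀ t ∈ Set.Ioo 0 T, HasDerivAt (X i n) (circuitRHS lam coeff X i n t) t) →
      (∀ (i : Fin m) (n : ℤ) (t : ℝ), n < 0 → X i n t = 0) →
      (∀ T' ∈ Set.Ioo 0 T, ∃ C : ℝ, ∀ (i : Fin m) (n : ℤ), ∀ t ∈ Set.Icc 0 T',
        lam ^ ((4 : ℝ) * n) * |X i n t| ≤ C) →
      (∃ M : ℝ, ∀ t ∈ Set.Ico 0 T, ∀ s : Finset ℤ,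
        ∑ n ∈ s, ∑ i : Fin m, (lam ^ ((1 / 5 : ℝ) * n) * |X i n t|) ^ 3 ≤ M) →
      ∃ C : ℝ, ∀ (i : Fin m) (n : ℤ), ∀ t ∈ Set.Ico 0 T, lam ^ ((4 : ℝ) * n) * |X i n t| ≤ C :=
  Iff.rfl

/-! ## Card `one-sided-source-cascade` — first lemma: PERSISTENCE-OR-BLAME

Structural fact used: in `circuitRHS … i j t` every term contains a factor `X · j t` EXCEPT the
single source `coeff i₁ i₂ i (some 2) * lam^{j-1} * X i₁ (j-1) t * X i₂ (j-1) t` from the scale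
below. Hence, in local time `τ = lam^{4j/5} t`, `d|X_{·,j}|/dτ ≥ -(1 + K A Mc)|X_{·,j}| - K A a_{j-1}²`
(critical units), which integrates to the inequality below. No symmetry/cancellation needed. -/

/-- PERSISTENCE-OR-BLAME (one scale, one window). `K` depends on `m` only. -/
def PersistenceOrBlame : Prop :=
  ∀ m : ℕ, ∃ K : ℝ, 0 < K ∧
    ∀ (lam : ℝ), 1 < lam → ∀ (coeff : Fin m → Fin m → Fin m → Option (Fin 3) → ℝ) (A : ℝ),
    (∀ i₁ i₂ i₃ μ, |coeff i₁ i₂ i₃ μ| ≤ A) →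
    ∀ (X : Fin m → ℤ → ℝ → ℝ) (j : ℤ) (t₀ t₁ Mc ρ : ℝ), t₀ ≤ t₁ → 0 ≤ ρ →
    (∀ i : Fin m, ∀ t ∈ Set.Icc t₀ t₁, HasDerivAt (X i j) (circuitRHS lam coeff X i j t) t) →
    (∀ t ∈ Set.Icc t₀ t₁, critAmp lam X j t ≤ Mc ∧ critAmp lam X (j + 1) t ≤ Mc ∧
        critAmp lam X (j - 1) t ≤ ρ) →
    Real.exp (-((1 + K * A * Mc) * (lam ^ ((4 / 5 : ℝ) * j) * (t₁ - t₀)))) * critAmp lam X j t₀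
        - K * A * (lam ^ ((4 / 5 : ℝ) * j) * (t₁ - t₀)) * ρ ^ 2
      ≤ critAmp lam X j t₁

/-! ## Card `ramp-energy-type-one-clock` — first lemma: TYPE-I CLOCK from the ℓ^∞-critical bound

Under the crux hypotheses minus ℓ³, plus only `sup_{n,t} a_n(t) ≤ Mc`: if the solution does
NOT stay H¹⁰-bounded up to `T`, then for a threshold `δ > 0` and a constant `C` there are times
`t_k ↑ T` with `T - t_k ≤ C lam^{-4k/5}` after which some scale `≥ k` is always `δ`-active.
(Proof sketch: ramp-weighted energy `W = Σ w_n |X_n|²`, ramp of width `K' ≍ A Mc³/δ²(1-lam^{-2/5})`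
below `k`; flux defect `≤ (K A Mc³/K') lam^{2k/5}/(1-lam^{-2/5})`, dissipation `≥ 2δ² lam^{2k/5}`
while a scale `≥ k` is `δ`-active, `0 ≤ W ≤ Mc² lam^{-2(k-K')/5}/(1-lam^{-2/5})`.) -/

/-- TYPE-I CLOCK (Type I in scale ⇒ Type I in time, front-localised), for Tao circuits. -/
def TypeIClock : Prop :=
  ∀ lam : ℝ, 1 < lam → ∀ (m : ℕ) (coeff : Fin m → Fin m → Fin m → Option (Fin 3) → ℝ),
    IsSym coeff → IsCyc coeff → ∀ T : ℝ, 0 < T → ∀ X : Fin m → ℤ → ℝ → ℝ,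
    (∀ (i : Fin m) (n : ℤ), ContinuousOn (X i n) (Set.Ico 0 T)) →
    (∀ (i : Fin m) (n : ℤ), ∀ t ∈ Set.Ioo 0 T, HasDerivAt (X i n) (circuitRHS lam coeff X i n t) t) →
    (∀ (i : Fin m) (n : ℤ) (t : ℝ), n < 0 → X i n t = 0) →
    (∀ T' ∈ Set.Ioo 0 T, ∃ C : ℝ, ∀ (i : Fin m) (n : ℤ), ∀ t ∈ Set.Icc 0 T',
      lam ^ ((4 : ℝ) * n) * |X i n t| ≤ C) →
    ∀ Mc : ℝ, (∀ n : ℤ, ∀ t ∈ Set.Ico 0 T, critAmp lam X n t ≤ Mc) →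
    (¬ ∃ C : ℝ, ∀ (i : Fin m) (n : ℤ), ∀ t ∈ Set.Ico 0 T, lam ^ ((4 : ℝ) * n) * |X i n t| ≤ C) →
    ∃ δ : ℝ, 0 < δ ∧ ∃ C : ℝ, ∀ k : ℕ, ∃ tk ∈ Set.Ico 0 T,
      T - tk ≤ C * lam ^ (-((4 / 5 : ℝ) * k)) ∧
      ∀ t ∈ Set.Ico tk T, ∃ n : ℤ, (k : ℤ) ≤ n ∧ δ ≤ critAmp lam X n t

/-! ## Card `minimal-trace-element` — first lemma: HALF-LATTICE BACKWARD UNIQUENESS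

The rigidity engine of the Kenig–Merle line (and of the ancient-limit packaging of card 1):
on the BI-INFINITE lattice, a solution with bounded critical amplitude that vanishes on a lower
half-lattice `{n ≤ N}` at the final time vanished there all along. One-line reason: on `{n ≤ N}`
the dissipation coefficient is `≤ lam^{4N/5}` (BOUNDED) and every interaction term feeding a mode
`n ≤ N` carries a factor `X_{n'}` with `n' ≤ n`, so `φ(s) = sup_{n ≤ N} a_n(s)` obeys the backward
Grönwall inequality `φ(s) ≤ φ(s₁) + L ∫_s^{s₁} φ`, `L = lam^{4N/5}(1 + K A Mc)`. No Carleman. -/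

/-- HALF-LATTICE BACKWARD UNIQUENESS in the critical weighted sup norm. -/
def HalfLatticeBackwardUniqueness : Prop :=
  ∀ lam : ℝ, 1 < lam → ∀ (m : ℕ) (coeff : Fin m → Fin m → Fin m → Option (Fin 3) → ℝ)
    (Z : Fin m → ℤ → ℝ → ℝ) (s₀ s₁ : ℝ) (N : ℤ) (Mc : ℝ), s₀ < s₁ →
    (∀ (i : Fin m) (n : ℤ), n ≤ N → ∀ s ∈ Set.Icc s₀ s₁,
      HasDerivAt (Z i n) (circuitRHS lam coeff Z i n s) s) →
    (∀ n : ℤ, ∀ s ∈ Set.Icc s₀ s₁, critAmp lam Z n s ≤ Mc) →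
    (∀ (i : Fin m) (n : ℤ), n ≤ N → Z i n s₁ = 0) →
    ∀ (i : Fin m) (n : ℤ), n ≤ N → ∀ s ∈ Set.Icc s₀ s₁, Z i n s = 0

/-! ## The band observability inequality (card 1, lever in quantitative form; for the record) -/

/-- BAND OBSERVABILITY: on a finite band `[nb, nt]` over a window of local length `≤ Γ₀` at the
band top, the band's critical sup cannot drop below `e^{-Γ}` of its initial value, up to the leak
entering through the band bottom from scale `nb - 1`. -/
def BandObservability : Prop :=
  ∀ m : ℕ, ∃ K : ℝ, 0 < K ∧
    ∀ (lam : ℝ), 1 < lam → ∀ (coeff : Fin m → Fin m → Fin m → Option (Fin 3) → ℝ) (A : ℝ),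
    (∀ i₁ i₂ i₃ μ, |coeff i₁ i₂ i₃ μ| ≤ A) →
    ∀ (X : Fin m → ℤ → ℝ → ℝ) (nb nt : ℤ) (t₀ t₁ Mc ρ : ℝ), nb ≤ nt → t₀ ≤ t₁ → 0 ≤ Mc → 0 ≤ ρ →
    (∀ (i : Fin m) (n : ℤ), nb ≤ n → n ≤ nt → ∀ t ∈ Set.Icc t₀ t₁,
      HasDerivAt (X i n) (circuitRHS lam coeff X i n t) t) →
    (∀ n : ℤ, ∀ t ∈ Set.Icc t₀ t₁, critAmp lam X n t ≤ Mc) →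
    (∀ t ∈ Set.Icc t₀ t₁, critAmp lam X (nb - 1) t ≤ ρ) →
    ∀ n₀ : ℤ, nb ≤ n₀ → n₀ ≤ nt →
      Real.exp (-((1 + K * A * Mc) * (lam ^ ((4 / 5 : ℝ) * nt) * (t₁ - t₀)))) * critAmp lam X n₀ t₀
        - Real.exp ((1 + K * A * Mc) * (lam ^ ((4 / 5 : ℝ) * nt) * (t₁ - t₀))) *
            K * A * (lam ^ ((4 / 5 : ℝ) * nb) * (t₁ - t₀)) * ρ ^ 2
      ≤ ⨆ n : Finset.Icc nb nt, critAmp lam X (n : ℤ) t₁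

end

end Summit.NavierStokesRegularity.NavierStokesRegularity.Cruxes.CircuitTrace.Ideator2
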